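import Summits.HodgeConjecture.HodgeCM.PerL34.GenuineTensorEmbed_1

/-! PORT of `HodgeCM/PerL34/GenuineTensorEmbed.lean` (HodgeCMPerL run 82) — part 2: continuation of `Summits.HodgeConjecture.HodgeCM.PerL34.GenuineTensorEmbed_1` (split at a top-level declaration boundary by port_pkg.py; scope re-opened below; declarations unchanged). -/

-- port_pkg: scope re-opened for this part (file-level context, then the namespace/section stack open at the cut)
set_option autoImplicit false
noncomputable section
open MeasureTheory MeasureTheory.Measure Set Metric Function Complex ComplexConjugate Topology Filter
open scoped RestrictedProduct InnerProductSpace NNReal ENNReal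
namespace HodgeCM.PerL34.RestrictedTensor.Genuine
open HodgeCM.PerL34.SplitShells HodgeCM.PerL34.AdelicFactorisation HodgeCM.PerL34.RestrictedMeasure
open HodgeCM.PerL34.NoSmallSubgroups HodgeCM.PerL34.EulerFactorisation HodgeCM.PerL34.DiscreteFD
open HodgeCM.PerL34.LocalFactors HodgeCM.PerL34.LocalFactors.DilationModel
open HodgeCM.PerL34.LocalModulus HodgeCM.PerL34.SplitPlaceDilation
open HodgeCM.PerL34.RallisIP HodgeCM.PerL34.Doubling HodgeCM.PerL34.N31d NumberField IsDedekindDomain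
open HodgeCM.PerL34.IdelePlaces HodgeCM.PerL34.RestrictedRegroup HodgeCM.PerL34.RestrictedCutout
open HodgeCM.PerL34.IdelicTorusModel HodgeCM.PerL34.IdelicTorusModel.Genuine HodgeCM.PerL34.PureTensor
attribute [local instance] LocalFactors.DilationModel.Adic.nontriviallyNormedField
  LocalFactors.DilationModel.Adic.properSpace
variable (L : Type) [Field L] [NumberField L] [IsCMField L]
set_option synthInstance.maxHeartbeats 200000 in
/-- **Consistency with pv09-g6 #4.**  On `Sp = ⊗′H` itself with the model EQUALITY `hω : D.ω = ⊗′ρ`, the kernel map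
`Φ := tp` (`hΦ` = the Gram identity `kernel_tp`, `hπ` = `rep_tp` under `hω`) gives back the statement of
`GenuineTensorEnd.exists_compactDomain_thetaLift_ne_zero_genuine_tensor` (pv09-g6 #4), since `lift tp (φ•) = φ•`. -/
theorem exists_compactDomain_thetaLift_ne_zero_genuine_tensor_of_eq [DecidableEq (Place (maximalRealSubfield L))]
    [∀ v : HeightOneSpectrum (𝓞 (maximalRealSubfield L)), MeasurableSpace (v.adicCompletion (maximalRealSubfield L))]
    [∀ v : HeightOneSpectrum (𝓞 (maximalRealSubfield L)), BorelSpace (v.adicCompletion (maximalRealSubfield L))]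
    (S₀ : Finset (Place (maximalRealSubfield L)))
    {W : Type} [AddCommGroup W] [Module L W]
    {H Sbox : Type} [Group H] [AddCommGroup Sbox] [Module ℂ Sbox]
    {h : W →ₗ⋆[L] W →ₗ[L] L} (hW : IsLine L W) (hh : Anisotropic h)
    (D : DoublingDatum (Model L) H (Space (unitFam L)) Sbox) (GU : ThetaSide (Space (unitFam L)) Sbox)
    (j : isomBox h →* H) (hj : ∀ d : unitary L, j ⟨iotaSnd d, iotaSnd_mem h d⟩ = D.ι (1, unitaryToModel L d))
    (χ : Model L →* Circle) (hχΓ : ∀ d : unitary L, χ (unitaryToModel L d) = 1)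
    (hχVΓ : ∀ d : unitary L, D.χV (unitaryToModel L d) = 1)
    {hP : ∀ Ψ : Sbox, ∀ p ∈ (stabDelta L W).subgroupOf (isomBox h), ∀ x : H, D.fSW Ψ (j p * x) = D.fSW Ψ x}
    (P : GluePrintInputs D GU h j hP)
    {T' : Finset (Place (maximalRealSubfield L))}
    (hχT' : RestrictedProduct.boxSubgroup (genLevel L) T' ≤ χ.ker)
    (hlocχ : ∀ i ∈ T', Continuous fun g : locTorus (maximalRealSubfield L) L i =>
      χ (RestrictedProduct.mulSingle (genLevel L) i g))
    {S : Finset (Place (maximalRealSubfield L))} (hT'S : T' ⊆ S)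
    (hS : ∀ v : InfinitePlace (maximalRealSubfield L), Sum.inl v ∈ S)
    {ν : ∀ i : Place (maximalRealSubfield L),
      ((basePlaceOf L i).adicCompletion (maximalRealSubfield L))ˣ →* Circle}
    (hν : ∀ i, i ∉ S → IsSplitPlace L i →
      ∀ u : ((basePlaceOf L i).adicCompletion (maximalRealSubfield L))ˣ,
        ‖(u : (basePlaceOf L i).adicCompletion (maximalRealSubfield L))‖ = 1 → ν i u = 1)
    (hνc : ∀ i, IsSplitPlace L i → Continuous (ν i))
    (x₀ : ∀ i : Place (maximalRealSubfield L), Fin 3 → (basePlaceOf L i).adicCompletion (maximalRealSubfield L))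
    (hx₀ : ∀ i ∈ S, IsSplitPlace L i → x₀ i ≠ 0)
    (hω : D.ω = rep (admissible L hν hχT')) [IsFiniteMeasure GU.μ] :
    ∃ 𝓕 : Set (Model L), IsCompact 𝓕 ∧ (interior 𝓕).Nonempty ∧ MeasurableSet 𝓕 ∧
      IsFundamentalDomain (unitaryToModel L).range 𝓕
        (haarDatum (genLevel L) (isCompact_genLevel L) (isOpen_genLevel L) S₀).μ ∧
      (haarDatum (genLevel L) (isCompact_genLevel L) (isOpen_genLevel L) S₀).μ 𝓕 ≠ 0 ∧
      (haarDatum (genLevel L) (isCompact_genLevel L) (isOpen_genLevel L) S₀).μ 𝓕 ≠ ⊤ ∧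
      ∀ [IsFiniteMeasure (((haarDatum (genLevel L) (isCompact_genLevel L) (isOpen_genLevel L) S₀).μ).restrict 𝓕)]
        (hk : Measurable (Function.uncurry
          (thetaFn D GU (phi L S x₀ (radius L S hνc hχT' hlocχ x₀ hx₀))))) {Ck : ℝ} (hCk : 0 ≤ Ck)
        (hkC : ∀ q u, ‖thetaFn D GU (phi L S x₀ (radius L S hνc hχT' hlocχ x₀ hx₀)) q u‖ ≤ Ck),
        PeterssonFubini.theta GU.μ
          (((haarDatum (genLevel L) (isCompact_genLevel L) (isOpen_genLevel L) S₀).μ).restrict 𝓕) hk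
          (measurable_coe_char (genLevel L) (isOpen_genLevel L) χ hχT' hlocχ) hCk hkC (norm_coe_char_le χ) ≠ 0 := by
  have hloc : ∀ (i : Place (maximalRealSubfield L)) (v : Space (unitFam L)),
      Continuous fun g : locTorus (maximalRealSubfield L) L i =>
        D.ω (RestrictedProduct.mulSingle (genLevel L) i g) v := by
    rw [hω]; exact fun i v => continuous_rep_mulSingle_apply L S hν hχT' hνc hlocχ i v
  have hπ : ∀ (g : Model L) (x : RVec (unitFam L)),
      D.ω g (tp (unitFam L) x) = tp (unitFam L) (gact (admissible L hν hχT') g x) := by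
    rw [hω]; exact fun g x => rep_tp (admissible L hν hχT') g x
  exact exists_compactDomain_thetaLift_ne_zero_genuine_tensor_of_kernelMap L S₀ hW hh D GU j hj χ hχΓ hχVΓ P hloc
    hχT' hlocχ hT'S hS hν hνc x₀ hx₀ (tp (unitFam L)) kernel_tp hπ

end HodgeCM.PerL34.RestrictedTensor.Genuine

end
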